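import Mathlib
import HarnessLib
import Literature.Analysis.Quadrature.MidpointTrapezoidPeanoKernel

/-!
# Divergent integrals: the prototype `∫₀¹ x^α dx` and the midpoint rule (Davis–Rabinowitz 1984, Sect. 2.12.10)

Davis & Rabinowitz, *Methods of Numerical Integration* (2nd ed., 1984), Sect. 2.12.10 *Divergent
Integrals*, take `I(α) = ∫₀¹ x^α dx` as a prototype:

* for `α ≥ 0` the integral is proper, for `-1 < α < 0` it is improper but convergent, and
  `I(α) = 1/(α + 1)` for all `α > -1` (`integral_rpow_unit`);
* for `α ≤ -1` the integral diverges (`not_integrableOn_rpow_unit`,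
  `integrableOn_rpow_unit_iff`), although `1/(α + 1)` continues analytically to every `α ≠ -1`;
* if the (compound) midpoint rule `M_n` ((2.1.3), `midpointRule` of
  `Literature.Analysis.Quadrature.MidpointTrapezoidPeanoKernel`) is applied to `x^α` with `α < -1`,
  all terms are positive and the first term alone is `(1/n)(1/(2n))^α = 2^{-α} · n^{-(1+α)}`
  (`midpointRule_rpow_first_term`), so that `M_n(x^α) ≥ 2^{-α} n^{-(1+α)}`
  (`first_term_le_midpointRule_rpow`) and, since `1 + α < 0`, `M_n(x^α) → +∞`
  (`tendsto_midpointRule_rpow_atTop`).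

The text adds that by a deeper analysis of midpoint-rule errors (Ninham) the divergent sequence can
be "summed" to the analytically continued value; that asymptotic analysis is not formalised here.

References: [cite: DavisRabinowitz1984, Sect. 2.12.10]; the midpoint rule is (2.1.3) of
[cite: DavisRabinowitz1984, Sect. 2.1 (2.1.3)].
-/

noncomputable section

open Real Set MeasureTheory intervalIntegral Filter Topology Finset

namespace Literature.Analysis.Quadrature

/-- `I(α) = ∫₀¹ x^α dx = 1/(α + 1)` for every `α > -1` (proper for `α ≥ 0`, improper but
convergent for `-1 < α < 0`). [cite: DavisRabinowitz1984, Sect. 2.12.10] -/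
theorem integral_rpow_unit {α : ℝ} (hα : -1 < α) :
    ∫ x in (0 : ℝ)..1, x ^ α = 1 / (α + 1) := by
  rw [integral_rpow (Or.inl hα)]
  have h : α + 1 ≠ 0 := by linarith
  simp [Real.zero_rpow h, Real.one_rpow]

/-- The prototype integrand `x^α` is integrable on `(0, 1)` exactly when `α > -1`.
[cite: DavisRabinowitz1984, Sect. 2.12.10] -/
theorem integrableOn_rpow_unit_iff {α : ℝ} :
    IntegrableOn (fun x : ℝ => x ^ α) (Ioo 0 1) ↔ -1 < α :=
  integrableOn_Ioo_rpow_iff zero_lt_one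

/-- For `α ≤ -1` the integral `∫₀¹ x^α dx` diverges: `x^α` is not integrable on `(0, 1)`.
[cite: DavisRabinowitz1984, Sect. 2.12.10] -/
theorem not_integrableOn_rpow_unit {α : ℝ} (hα : α ≤ -1) :
    ¬ IntegrableOn (fun x : ℝ => x ^ α) (Ioo 0 1) := by
  rw [integrableOn_rpow_unit_iff]
  exact not_lt.mpr hα

/-- For `α ≤ -1`, `x^α` is not interval-integrable on `[0, 1]` either.
[cite: DavisRabinowitz1984, Sect. 2.12.10] -/
theorem not_intervalIntegrable_rpow_unit {α : ℝ} (hα : α ≤ -1) :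
    ¬ IntervalIntegrable (fun x : ℝ => x ^ α) volume 0 1 := by
  rw [intervalIntegrable_iff_integrableOn_Ioo_of_le zero_le_one]
  exact not_integrableOn_rpow_unit hα

/-- The value `1/(α + 1)` of the convergent integral continues analytically (as a function of the
real parameter `α`) to every `α ≠ -1`. [cite: DavisRabinowitz1984, Sect. 2.12.10] -/
theorem analyticAt_inv_add_one {α : ℝ} (hα : α ≠ -1) :
    AnalyticAt ℝ (fun a : ℝ => 1 / (a + 1)) α := by
  have h : α + 1 ≠ 0 := fun h => hα (by linarith)
  have h1 : AnalyticAt ℝ (fun a : ℝ => a + 1) α := analyticAt_id.add analyticAt_const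
  exact analyticAt_const.div h1 h

/-- The midpoint rule `M_n` on `[0, 1]` applied to `x^α`, written out:
`M_n(x^α) = ∑_{k<n} (1/n) ((k + 1/2)/n)^α`. [cite: DavisRabinowitz1984, Sect. 2.12.10]
[cite: DavisRabinowitz1984, Sect. 2.1 (2.1.3)] -/
theorem midpointRule_rpow_eq (α : ℝ) (n : ℕ) :
    midpointRule (fun x : ℝ => x ^ α) n 0 1 =
      ∑ k ∈ range n, (1 / (n : ℝ)) * (((k : ℝ) + 2⁻¹) / n) ^ α := by
  simp [midpointRule, div_eq_mul_inv]

/-- Every term of `M_n(x^α)` is positive (`n ≥ 1`). [cite: DavisRabinowitz1984, Sect. 2.12.10] -/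
theorem midpointRule_rpow_term_pos (α : ℝ) {n : ℕ} (hn : n ≠ 0) (k : ℕ) :
    0 < (1 / (n : ℝ)) * (((k : ℝ) + 2⁻¹) / n) ^ α := by
  have hn' : (0 : ℝ) < n := Nat.cast_pos.mpr (Nat.pos_of_ne_zero hn)
  have hk : (0 : ℝ) < ((k : ℝ) + 2⁻¹) / n := by positivity
  exact mul_pos (by positivity) (Real.rpow_pos_of_pos hk α)

/-- The first term of `M_n(x^α)` is `(1/n)(1/(2n))^α = 2^{-α} · n^{-(1+α)}`.
[cite: DavisRabinowitz1984, Sect. 2.12.10] -/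
theorem midpointRule_rpow_first_term (α : ℝ) {n : ℕ} (hn : n ≠ 0) :
    (1 / (n : ℝ)) * ((((0 : ℕ) : ℝ) + 2⁻¹) / n) ^ α = (2 : ℝ) ^ (-α) * (n : ℝ) ^ (-(1 + α)) := by
  have hn' : (0 : ℝ) < n := Nat.cast_pos.mpr (Nat.pos_of_ne_zero hn)
  have h1 : (((0 : ℕ) : ℝ) + 2⁻¹) / n = (2 : ℝ)⁻¹ * (n : ℝ)⁻¹ := by
    simp [div_eq_mul_inv]
  rw [h1, Real.mul_rpow (by norm_num) (inv_nonneg.mpr hn'.le), Real.inv_rpow (by norm_num),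
    Real.inv_rpow hn'.le, ← Real.rpow_neg (by norm_num), ← Real.rpow_neg hn'.le, neg_add,
    Real.rpow_add hn', Real.rpow_neg_one]
  ring

/-- `M_n(x^α) ≥ 2^{-α} n^{-(1+α)}`: the midpoint sum dominates its (positive) first term.
[cite: DavisRabinowitz1984, Sect. 2.12.10] -/
theorem first_term_le_midpointRule_rpow (α : ℝ) {n : ℕ} (hn : n ≠ 0) :
    (2 : ℝ) ^ (-α) * (n : ℝ) ^ (-(1 + α)) ≤ midpointRule (fun x : ℝ => x ^ α) n 0 1 := by
  rw [midpointRule_rpow_eq, ← midpointRule_rpow_first_term α hn]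
  have h0 : 0 ∈ range n := Finset.mem_range.mpr (Nat.pos_of_ne_zero hn)
  exact Finset.single_le_sum (f := fun k : ℕ => (1 / (n : ℝ)) * (((k : ℝ) + 2⁻¹) / n) ^ α)
    (fun k _ => (midpointRule_rpow_term_pos α hn k).le) h0

/-- `M_n(x^α) > 0` for `n ≥ 1`. [cite: DavisRabinowitz1984, Sect. 2.12.10] -/
theorem midpointRule_rpow_pos (α : ℝ) {n : ℕ} (hn : n ≠ 0) :
    0 < midpointRule (fun x : ℝ => x ^ α) n 0 1 :=
  lt_of_lt_of_le (by positivity) (first_term_le_midpointRule_rpow α hn)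

/-- For `α < -1` (so `1 + α < 0`) the lower bound `2^{-α} n^{-(1+α)}` tends to `+∞`.
[cite: DavisRabinowitz1984, Sect. 2.12.10] -/
theorem tendsto_midpointRule_rpow_firstTerm_atTop {α : ℝ} (hα : α < -1) :
    Tendsto (fun n : ℕ => (2 : ℝ) ^ (-α) * (n : ℝ) ^ (-(1 + α))) atTop atTop := by
  have hpos : 0 < -(1 + α) := by linarith
  refine Tendsto.const_mul_atTop (by positivity) ?_
  exact (tendsto_rpow_atTop hpos).comp tendsto_natCast_atTop_atTop

/-- **Divergence of the midpoint sums** (Davis–Rabinowitz, Sect. 2.12.10): for `α < -1` the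
sequence of midpoint rules applied to `x^α` on `[0, 1]` tends to `+∞`, `M_n(x^α) → +∞`.
[cite: DavisRabinowitz1984, Sect. 2.12.10] -/
theorem tendsto_midpointRule_rpow_atTop {α : ℝ} (hα : α < -1) :
    Tendsto (fun n : ℕ => midpointRule (fun x : ℝ => x ^ α) n 0 1) atTop atTop := by
  refine tendsto_atTop_mono' atTop ?_ (tendsto_midpointRule_rpow_firstTerm_atTop hα)
  filter_upwards [eventually_ne_atTop 0] with n hn
  exact first_term_le_midpointRule_rpow α hn

/-- In particular the midpoint sums of a divergent prototype integral are unbounded: for every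
bound `B` eventually `M_n(x^α) > B`. [cite: DavisRabinowitz1984, Sect. 2.12.10] -/
theorem eventually_lt_midpointRule_rpow {α : ℝ} (hα : α < -1) (B : ℝ) :
    ∀ᶠ n : ℕ in atTop, B < midpointRule (fun x : ℝ => x ^ α) n 0 1 :=
  (tendsto_midpointRule_rpow_atTop hα).eventually_gt_atTop B

end Literature.Analysis.Quadrature

end
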